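import Mathlib
import Literature.AlgebraicGeometry.CossartPiltant200819.Thm15iBaseSidePhase2019
import Summits.ResolutionOfSingularities.ResolutionOfSingularities.Theorems.RadicialJungCleanModelsCleanLU3DimThreeCentre
import Literature.AlgebraicGeometry.Resolution.LocalBlowup
import Literature.AlgebraicGeometry.Resolution.ExcellentRings
import Literature.AlgebraicGeometry.Resolution.ExcellentRingsEssFiniteType
import Literature.AlgebraicGeometry.Resolution.ExcellentRingsFieldProofs
import Literature.AlgebraicGeometry.Resolution.TranscendenceDefect
import HarnessLib

/-!
# Crux stmt-ResolutionOfSingularities-15917 (`RadicialJung.CleanModels`), skeleton `Sketch` rev 31 — the `p = 2` SLICE of the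
# research stub `stub_cleanLU3DefectNonDiscrete` (indeed of the whole node `cleanLU3`), KERNEL-CLOSED modulo the typed printed
# theorem Cossart–Piltant 2019, Thm 1.5 (i) read base-side (`Literature.AlgebraicGeometry.CossartPiltant200819.
# CossartPiltant2019_thm_1_5_i_baseSidePhase`, file `Thm15iBaseSidePhase2019.lean`, INPUTS work item wi-91399)

PORT-READY, DEF-FREE rewrite (res-B-lens-5 g18, lens 5 «transfer from the solved sibling (CP 2019 arbitrary fields)», crux
stmt-ResolutionOfSingularities-0549 `Theses.Descent.DescentPerfectToAll`, slot `via_clean_models` ⟸ stmt-15917) of the `p = 2`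
tooth of the lens-5 census `Cruxes/DescentPerfectToAll/Census_lens5_cpBaseSide.lean` rev 1.7 (§2 `CpBaseSidePhaseAt`, §3b
`exists_lowMultModel_of_baseSidePhaseAt`, `lowMultToCleanAt_two`, `cleanLU3At_two_of_baseSidePhaseAt_two`), now that the
hypothesis shape `∀ p, p.Prime → CpBaseSidePhaseAt p` IS a typed Literature fact (token for token).  OURS · counted 0.
**Nothing here proves resolution in characteristic `p`; nothing is claimed about characteristic `p ≥ 3`; Hironaka 2017 is
not used.**  The only printed input is carried BY NAME as the hypothesis `hBS : CossartPiltant2019_thm_1_5_i_baseSidePhase`.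

## Mathematics (one paragraph)

At `p = 2` the printed end-state «multiplicity `m(x_n) < p`» of the base-side phase of Cossart–Piltant's Theorem 1.5 (i)
(Cor. 5.6: Cor. 4.19 + Thm. 2.81 + Thm. 5.5; every blowing up of that phase is the base square (2.17) of Prop. 2.22 with
radicand rule (2.18) `g' = c^p g + d^p`) reads `m(x_n) = 1`, i.e. `∀ c ∈ B_n, g_n - c² ∉ 𝔪²` at the last regular local ring
`B_n` of the tower ([31] = Cossart–Piltant RACSAM 108 (2014), p. 116 l. 13–14: «(X, x) is already regular if p = 2»: the second
phase is EMPTY at `p = 2`).  Transported to the customer's currency exactly as in ✓ `cleanLU_of_frame_of_dimThreeCentre`: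
the local ring `S = A_𝔭` of the finitely generated model `A ⊆ O` at the centre of `O` is excellent (`isExcellentRing_of_
finiteType_field`, `IsExcellentRing.of_isLocalization`) regular of dimension `3` with `Frac S = K`; the radicand `g₀ = a/b` is
moved into `S` as `f = a b^{p-1} = b^p g₀`; the printed tower is a chain of local blowing ups, so `B_n = (A[t])_𝔭'` for a
finite set `t ⊆ O` of chart generators (`exists_eq_locAtCentre_of_reflTransGen`, `PfaffLine.locAtCentre_closure_locAtCentre_
union`); along the tower `g_n = C^p f + D^p` with `C ≠ 0` (`exists_line_of_tower`), a NON-TRIVIAL representative of the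
`K^p`-line of `g₀`.  At `p = 2`, «`G - c² ∉ 𝔪²` for every `c`» at the regular local ring `(A[t])_𝔭'` is loose clean form (3)
(if some `G - c'² ∈ 𝔪`: then `G - c'² ∈ 𝔪 ∖ 𝔪²`) or form (2) (else `G` is a unit not residually a square) — AT THAT MODEL,
no further blowing up.  So the node `cleanLU3` of the skeleton holds at `p = 2` for EVERY valuation ring `O` (immediate or not,
any rank) over EVERY field `k` of characteristic `2` (perfect or not), modulo the printed theorem alone.

## What the lead can do with it (proposal, not done here — the skeleton is the lead's)

Sketch rev 32 := rev 31 with (i) a seventh registered stub, PRINTED: `theorem stub_cp2019Thm15iBaseSidePhase :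
CossartPiltant2019_thm_1_5_i_baseSidePhase.{0} := by sorry` (keys the typed fact wi-91399 in the INPUTS register — the desk's
keying condition «a registered `p = 2` child» of INPUTS-v9.3 is then met); (ii) the research stub `stub_cleanLU3DefectNonDiscrete`
NARROWED by one more binder `p ≠ 2 →` right after `p.Prime →`; (iii) in `cleanLU3DefectNonDiscrete_of_stubs`, last branch,
`by_cases hp2 : p = 2` — `exact Lens5.PTwo.cleanLU3DefectNonDiscrete_of_eq_two stub_cp2019Thm15iBaseSidePhase p hp hp2 k K O A
hAO hAfg hfrac hdimA hreg hdim3 hzd g₀ hg₀ hdefect htd hdisc hdiv hT halg hCc` / `exact stub_cleanLU3DefectNonDiscrete p hp hp2 …`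
(or, one level up, `Lens5.PTwo.cleanLU3_of_eq_two` at the top of `cleanLU3_of_stubs`).  Per-prime wording of the rung-B footnote is
already the registrar's #6d of record («p = 2: printed corollary; odd p: research»).

Source (published, refereed): V. Cossart, O. Piltant, *Resolution of singularities of arithmetical threefolds*, J. Algebra
**529** (2019) 268–535 [CossartPiltant2019]: Thm. 1.5 (i) pp. 271–272; Cor. 5.6 p. 405 (proof); Prop. 2.22 with (2.17)/(2.18)
pp. 294–295; Prop. 2.10 p. 288; Thm. 2.81 p. 341; Lemma 4.14 p. 398; Cor. 4.19 p. 402; (5.3) p. 404; Thm. 5.5 p. 405; and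
V. Cossart, O. Piltant, RACSAM **108** (2014) 113–151 [CossartPiltant2014], p. 116 («already regular if p = 2»).
**Caveat: the hypothesis types a printed theorem read through the structure of its printed proof (docstring of the Literature
file); AI reading is weaker than expert review.**
-/

/-! REV 2 (2026-08-29, after res-B-crit-1 g9 TRIAGE-154 PASS, sharpen (7)): the printed input is now ALSO offered as the
`p = 2` INSTANCE ONLY — `exists_lowMultModel_of_baseSidePhaseAt p hp (hBSp : <fact body at p>)`, `cleanLU3_two_of_baseSidePhaseTwo
(hBS2 : <fact body at 2>)`, wrappers `cleanLU3_of_eq_two_of_phaseTwo` / `cleanLU3DefectNonDiscrete_of_eq_two_of_phaseTwo (hBS2 : <fact body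
at 2>)` — so that the lead may register the p = 2-specialised printed stub `stub_cp2019Thm15iBaseSidePhaseTwo : <fact body at 2>`
(= `CossartPiltant2019_thm_1_5_i_baseSidePhase` at `p = 2`, kernel: `baseSidePhaseTwo_of_cp2019`) and the skeleton's printed debt is
exactly what is consumed (no odd-`p` reading of the fact enters the skeleton).  All rev-1 names and statements are KEPT (now one-line
corollaries via `hBS 2 Nat.prime_two`), so TRIAGE-154's stmtdiff stands. -/

noncomputable section

set_option linter.dupNamespace false

open IsLocalRing Polynomial
open Literature.AlgebraicGeometry.Resolution
open Literature.AlgebraicGeometry.CossartPiltant200819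
open Summit.ResolutionOfSingularities.ResolutionOfSingularities.Theorems

namespace Summit.ResolutionOfSingularities.ResolutionOfSingularities.Theorems.RadicialJung.CleanModels.Lens5.PTwo

/-! ## §1 The end state of the printed phase on a finitely generated model (every `p`) -/

/-- **The END STATE of Cossart–Piltant's base-side phase, in the customer's currency (every prime `p`).**  From the printed
theorem `CossartPiltant2019_thm_1_5_i_baseSidePhase` at a 3-dimensional regular centre of a finitely generated model `A ⊆ O` of
`K` over a field `k` of characteristic `p`, for `g₀ ∈ K ∖ K^p`: a finitely generated enlargement `A ⊆ A' ⊆ O` (`A' = A[t]`, `t`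
the chart generators of the printed tower), still with fraction field `K`, REGULAR at the centre of `O` (its local ring there is
Cossart–Piltant's `B_n`), carrying a representative `C^p g₀ + D^p` (`C ≠ 0`) of the `K^p`-line of `g₀` of multiplicity `< p`:
`(C^p g₀ + D^p) - c^p ∉ 𝔪^p` for every `c` in that local ring.  Plumbing verbatim that of ✓ `cleanLU_of_frame_of_dimThreeCentre`.
[cite: CossartPiltant2019, Thm. 1.5 (i) pp. 271–272; Cor. 5.6 p. 405; Prop. 2.22 (2.17)/(2.18) pp. 294–295] -/
theorem exists_lowMultModel_of_baseSidePhaseAt (p : ℕ) (hp : p.Prime)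
    (hBSp : (∀ (S : Type) [CommRing S] [IsRegularLocalRing S],
          IsExcellentRing S → ringKrullDim S = 3 → CharP S p →
          ∀ (K : Type) [Field K] [Algebra S K] [IsFractionRing S K] (f : S),
          (∀ c : K, c ^ p ≠ algebraMap S K f) →
          ∀ (O : ValuationSubring K), (algebraMap S K).range ≤ O.toSubring →
          (∀ s ∈ IsLocalRing.maximalIdeal S, O.valuation (algebraMap S K s) < 1) →
          ∃ (n : ℕ) (B : ℕ → Subring K) (g : ℕ → K),
          B 0 = locAtCentre (algebraMap S K).range O ∧ g 0 = algebraMap S K f ∧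
          (∀ i ≤ n, B i ≤ O.toSubring ∧ IsRegularLocalRing (B i) ∧ g i ∈ B i) ∧
          (∀ i < n, ∃ P : Ideal (B i), IsRegularLocalRing ((B i) ⧸ P) ∧
            IsLocalBlowupAlong O (B i) P (B (i + 1)) ∧
            ∃ c d : K, c ≠ 0 ∧ g (i + 1) = c ^ p * g i + d ^ p) ∧
          ∀ (hg : g n ∈ B n) (_hBn : IsRegularLocalRing (B n)) (c : B n),
            (⟨g n, hg⟩ : B n) - c ^ p ∉ IsLocalRing.maximalIdeal (B n) ^ p))
    (k : Type) [Field k] [CharP k p] (K : Type) [Field K] [Algebra k K]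
    (O : ValuationSubring K) (A : Subalgebra k K) (hAO : A.toSubring ≤ O.toSubring) (hAfg : A.FG)
    (hfrac : IsFractionRing A K) (hreg : IsRegularLocalRing (locAtCentre A.toSubring O))
    (hdim3 : ringKrullDim (locAtCentre A.toSubring O) = 3) (g₀ : K) (hg₀ : ∀ c : K, c ^ p ≠ g₀) :
    ∃ (A' : Subalgebra k K) (_ : A'.toSubring ≤ O.toSubring) (_ : A ≤ A') (_ : A'.FG) (_ : IsFractionRing A' K)
      (_ : IsRegularLocalRing (locAtCentre A'.toSubring O))
      (C D : K) (hG : C ^ p * g₀ + D ^ p ∈ locAtCentre A'.toSubring O), C ≠ 0 ∧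
        ∀ c : ↥(locAtCentre A'.toSubring O),
          (⟨C ^ p * g₀ + D ^ p, hG⟩ : ↥(locAtCentre A'.toSubring O)) - c ^ p ∉
            IsLocalRing.maximalIdeal ↥(locAtCentre A'.toSubring O) ^ p := by
  classical
  haveI : Fact p.Prime := ⟨hp⟩
  haveI := hreg
  set S : Subring K := locAtCentre A.toSubring O with hSdef
  have hSO : S ≤ O.toSubring := locAtCentre_le hAO
  have hAS : A.toSubring ≤ S := le_locAtCentre A.toSubring O
  -- characteristic
  haveI : CharP K p := charP_of_injective_algebraMap (algebraMap k K).injective p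
  haveI hSp : CharP S p := (S.subtype).charP Subtype.val_injective p
  -- `S` is excellent: a localisation of the finitely generated `k`-algebra `A`
  haveI : Algebra.FiniteType k A := (Subalgebra.fg_iff_finiteType A).mp hAfg
  have hexcA : IsExcellentRing A := isExcellentRing_of_finiteType_field k A
  haveI := isLocalization_locAtCentre (K := K) (O := O) hAO
  have hexcS : IsExcellentRing S :=
    IsExcellentRing.of_isLocalization (A := A.toSubring) (B := S) (subringCentre A.toSubring O hAO).primeCompl hexcA
  -- `K = Frac S`
  haveI : IsFractionRing S K := by
    refine IsFractionRing.of_field S K fun z => ?_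
    obtain ⟨a, b, -, hab⟩ := IsFractionRing.div_surjective (A := A) z
    exact ⟨⟨a, hAS a.2⟩, ⟨b, hAS b.2⟩, hab.symm⟩
  -- the radicand moved into `A ⊆ S`: `g₀ = a / b`, `f = a b^{p-1} = b^p g₀`
  obtain ⟨a, b, hb, hab⟩ := IsFractionRing.div_surjective (A := A) g₀
  have hb0 : (b : K) ≠ 0 := by
    intro h
    have : (b : A) = 0 := Subtype.ext h
    exact (nonZeroDivisors.ne_zero hb) this
  have hab' : g₀ = (a : K) / (b : K) := hab.symm
  set f : S := ⟨(a : K) * (b : K) ^ (p - 1), S.mul_mem (hAS a.2) (S.pow_mem (hAS b.2) _)⟩ with hfdef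
  have hfK : ((f : S) : K) = (b : K) ^ p * g₀ := by
    rw [hfdef, hab']
    have : (b : K) ^ p = (b : K) ^ (p - 1) * b := by
      rw [← pow_succ, Nat.sub_add_cancel hp.one_lt.le]
    rw [this]
    field_simp
  have hfp : ∀ c : K, c ^ p ≠ algebraMap S K f := by
    intro c hc
    apply hg₀ (c / b)
    rw [div_pow, hc]
    change ((f : S) : K) / (b : K) ^ p = g₀
    rw [hfK]
    field_simp
  -- domination
  have hrange : (algebraMap S K).range ≤ O.toSubring := by
    rintro _ ⟨s, rfl⟩
    exact hSO s.2
  have hdom : ∀ s ∈ IsLocalRing.maximalIdeal S, O.valuation (algebraMap S K s) < 1 := by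
    intro s hs
    exact (mem_maximalIdeal_locAtCentre_iff hAO s).mp hs
  -- THE PRINTED PHASE (the named fact, at the prime `p`)
  obtain ⟨n, B, g, hB0, hg0, hBall, hstep, hend⟩ := hBSp S hexcS hdim3 hSp K f hfp O hrange hdom
  have hrangeS : (algebraMap S K).range = S := by
    ext x
    constructor
    · rintro ⟨s, rfl⟩; exact s.2
    · intro hx; exact ⟨⟨x, hx⟩, rfl⟩
  have hB0' : B 0 = S := by rw [hB0, hrangeS, hSdef, locAtCentre_locAtCentre]
  -- the tower is a chain of local blowing ups; `B n` is the local ring at the centre of a finitely generated model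
  obtain ⟨hT, hBnloc⟩ := reflTransGen_of_steps O B n (by rw [hB0', hSdef, locAtCentre_locAtCentre])
    (fun i hi => by obtain ⟨P, -, hP, -⟩ := hstep i hi; exact ⟨P, hP⟩)
  obtain ⟨-, t, htO, hBn⟩ := exists_eq_locAtCentre_of_reflTransGen (by rw [hB0']; exact hSO) hT
  rw [hBnloc, hB0', hSdef, PfaffLine.locAtCentre_closure_locAtCentre_union] at hBn
  -- the finitely generated model `A' = A[t]`
  let A' : Subalgebra k K :=
    { Subring.closure ((A.toSubring : Set K) ∪ ↑t) with
      algebraMap_mem' := fun r => Subring.subset_closure (Or.inl (A.algebraMap_mem r)) }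
  have hA'sub : A'.toSubring = Subring.closure ((A.toSubring : Set K) ∪ ↑t) := rfl
  have hAA' : A ≤ A' := fun x hx => Subring.subset_closure (Or.inl hx)
  have hA'O : A'.toSubring ≤ O.toSubring := by
    rw [hA'sub, Subring.closure_le]
    rintro x (hx | hx)
    · exact hAO hx
    · exact htO hx
  have hA'fg : A'.FG := by
    obtain ⟨s₀, hs₀⟩ := hAfg
    refine ⟨s₀ ∪ t, le_antisymm ?_ ?_⟩
    · rw [Algebra.adjoin_le_iff]
      rintro x hx
      rw [Finset.coe_union] at hx
      rcases hx with hx | hx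
      · exact hAA' (hs₀ ▸ Algebra.subset_adjoin hx)
      · exact Subring.subset_closure (Or.inr hx)
    · intro x hx
      change x ∈ Subring.closure ((A.toSubring : Set K) ∪ ↑t) at hx
      have hle : Subring.closure ((A.toSubring : Set K) ∪ ↑t) ≤ (Algebra.adjoin k (↑(s₀ ∪ t) : Set K)).toSubring := by
        rw [Subring.closure_le]
        rintro y (hy | hy)
        · have : y ∈ Algebra.adjoin k (s₀ : Set K) := by rw [hs₀]; exact hy
          exact Algebra.adjoin_mono (by rw [Finset.coe_union]; exact Set.subset_union_left) this
        · exact Algebra.subset_adjoin (by rw [Finset.coe_union]; exact Or.inr hy)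
      exact hle hx
  have hBnA' : B n = locAtCentre A'.toSubring O := by rw [hA'sub]; exact hBn
  have hfracA' : IsFractionRing A' K := by
    refine IsFractionRing.of_field A' K fun z => ?_
    obtain ⟨a₁, b₁, -, hab₁⟩ := IsFractionRing.div_surjective (A := A) z
    exact ⟨⟨a₁, hAA' a₁.2⟩, ⟨b₁, hAA' b₁.2⟩, hab₁.symm⟩
  -- facts about `B n`
  obtain ⟨hBnO, hBnreg, hgn⟩ := hBall n le_rfl
  have hregA' : IsRegularLocalRing (locAtCentre A'.toSubring O) := by rw [← hBnA']; exact hBnreg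
  -- `g n` in the `K^p`-line of `f`, hence of `g₀`
  obtain ⟨C, D, hC, hline⟩ := exists_line_of_tower p (algebraMap S K f) g hg0 n
    (fun i hi => by obtain ⟨-, -, -, hcd⟩ := hstep i hi; exact hcd)
  have hfK' : (algebraMap S K) f = (b : K) ^ p * g₀ := hfK
  have hGeq : (C * (b : K)) ^ p * g₀ + D ^ p = g n := by
    rw [hline, hfK', mul_pow]; ring
  have hgn' : g n ∈ locAtCentre A'.toSubring O := by rw [← hBnA']; exact hgn
  have hGmem : (C * (b : K)) ^ p * g₀ + D ^ p ∈ locAtCentre A'.toSubring O := by rw [hGeq]; exact hgn'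
  -- the end-state `m < p`, transported to the local ring of `A'` at the centre
  have hend' : ∀ (hg : g n ∈ locAtCentre A'.toSubring O) (_h : IsRegularLocalRing ↥(locAtCentre A'.toSubring O))
      (c : ↥(locAtCentre A'.toSubring O)),
      (⟨g n, hg⟩ : ↥(locAtCentre A'.toSubring O)) - c ^ p ∉
        IsLocalRing.maximalIdeal ↥(locAtCentre A'.toSubring O) ^ p := by
    rw [← hBnA']; exact hend
  haveI := hregA'
  have hmultG : ∀ c : ↥(locAtCentre A'.toSubring O),
      (⟨(C * (b : K)) ^ p * g₀ + D ^ p, hGmem⟩ : ↥(locAtCentre A'.toSubring O)) - c ^ p ∉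
        IsLocalRing.maximalIdeal ↥(locAtCentre A'.toSubring O) ^ p := by
    intro c
    have heq : (⟨(C * (b : K)) ^ p * g₀ + D ^ p, hGmem⟩ : ↥(locAtCentre A'.toSubring O)) = ⟨g n, hgn'⟩ :=
      Subtype.ext hGeq
    rw [heq]
    exact hend' hgn' hregA' c
  exact ⟨A', hA'O, hAA', hA'fg, hfracA', hregA', C * (b : K), D, hGmem, mul_ne_zero hC hb0, hmultG⟩

/-- (rev-1 name, KEPT) the END STATE from the printed fact BY NAME, every `p`: `exists_lowMultModel_of_baseSidePhaseAt p hp (hBS p hp)`.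
[cite: CossartPiltant2019, Thm. 1.5 (i) pp. 271–272; Cor. 5.6 p. 405; Prop. 2.22 (2.17)/(2.18) pp. 294–295] -/
theorem exists_lowMultModel_of_cp2019BaseSidePhase (hBS : CossartPiltant2019_thm_1_5_i_baseSidePhase.{0})
    (p : ℕ) (hp : p.Prime)
    (k : Type) [Field k] [CharP k p] (K : Type) [Field K] [Algebra k K]
    (O : ValuationSubring K) (A : Subalgebra k K) (hAO : A.toSubring ≤ O.toSubring) (hAfg : A.FG)
    (hfrac : IsFractionRing A K) (hreg : IsRegularLocalRing (locAtCentre A.toSubring O))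
    (hdim3 : ringKrullDim (locAtCentre A.toSubring O) = 3) (g₀ : K) (hg₀ : ∀ c : K, c ^ p ≠ g₀) :
    ∃ (A' : Subalgebra k K) (_ : A'.toSubring ≤ O.toSubring) (_ : A ≤ A') (_ : A'.FG) (_ : IsFractionRing A' K)
      (_ : IsRegularLocalRing (locAtCentre A'.toSubring O))
      (C D : K) (hG : C ^ p * g₀ + D ^ p ∈ locAtCentre A'.toSubring O), C ≠ 0 ∧
        ∀ c : ↥(locAtCentre A'.toSubring O),
          (⟨C ^ p * g₀ + D ^ p, hG⟩ : ↥(locAtCentre A'.toSubring O)) - c ^ p ∉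
            IsLocalRing.maximalIdeal ↥(locAtCentre A'.toSubring O) ^ p :=
  exists_lowMultModel_of_baseSidePhaseAt p hp (hBS p hp) k K O A hAO hAfg hfrac hreg hdim3 g₀ hg₀

/-- The `p = 2` instance of the printed fact (the proposed p = 2-specialised registered stub is exactly this type). -/
theorem baseSidePhaseTwo_of_cp2019 (hBS : CossartPiltant2019_thm_1_5_i_baseSidePhase.{0}) :
    (∀ (S : Type) [CommRing S] [IsRegularLocalRing S],
          IsExcellentRing S → ringKrullDim S = 3 → CharP S 2 →
          ∀ (K : Type) [Field K] [Algebra S K] [IsFractionRing S K] (f : S),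
          (∀ c : K, c ^ 2 ≠ algebraMap S K f) →
          ∀ (O : ValuationSubring K), (algebraMap S K).range ≤ O.toSubring →
          (∀ s ∈ IsLocalRing.maximalIdeal S, O.valuation (algebraMap S K s) < 1) →
          ∃ (n : ℕ) (B : ℕ → Subring K) (g : ℕ → K),
          B 0 = locAtCentre (algebraMap S K).range O ∧ g 0 = algebraMap S K f ∧
          (∀ i ≤ n, B i ≤ O.toSubring ∧ IsRegularLocalRing (B i) ∧ g i ∈ B i) ∧
          (∀ i < n, ∃ P : Ideal (B i), IsRegularLocalRing ((B i) ⧸ P) ∧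
            IsLocalBlowupAlong O (B i) P (B (i + 1)) ∧
            ∃ c d : K, c ≠ 0 ∧ g (i + 1) = c ^ 2 * g i + d ^ 2) ∧
          ∀ (hg : g n ∈ B n) (_hBn : IsRegularLocalRing (B n)) (c : B n),
            (⟨g n, hg⟩ : B n) - c ^ 2 ∉ IsLocalRing.maximalIdeal (B n) ^ 2) :=
  hBS 2 Nat.prime_two

/-! ## §2 The `p = 2` slice of the node `cleanLU3` (every valuation ring, every field of characteristic `2`) -/

/-- **Clean local uniformization at 3-dimensional centres in characteristic `2`, modulo Cossart–Piltant 2019 Thm 1.5 (i) read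
base-side.**  For EVERY valuation ring `O` of `K ⊇ k`, `char k = 2`, every finitely generated model `A ⊆ O` with `Frac A = K` whose
local ring at the centre of `O` is regular of dimension `3`, and every non-square `g₀ ∈ K`: a finitely generated `A ⊆ A' ⊆ O`,
regular at the centre of `O`, carrying there a loosely clean non-trivial representative `c₀² + c₁² g₀` of the `K²`-line of `g₀`
(form (2): a unit not residually a square, or form (3): `s - c'² ∈ 𝔪 ∖ 𝔪²`).  This is the statement of the node `cleanLU3` of
`Cruxes/CleanModels/Lines/Sketch.lean` (rev 31, `cleanLU3_of_stubs`) at `p = 2`, without its hypotheses `ringKrullDim A ≤ 3`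
and «all centres above `A` maximal» (not needed).  At `p = 2` multiplicity `< 2` at the last regular local ring of the printed
tower is cleanness AT THAT RING; nothing is claimed for `p ≥ 3`.
[cite: CossartPiltant2019, Thm. 1.5 (i) pp. 271–272; Cor. 5.6 p. 405; Prop. 2.22 pp. 294–295; CossartPiltant2014, p. 116] -/
theorem cleanLU3_two_of_baseSidePhaseTwo
    (hBS2 : (∀ (S : Type) [CommRing S] [IsRegularLocalRing S],
          IsExcellentRing S → ringKrullDim S = 3 → CharP S 2 →
          ∀ (K : Type) [Field K] [Algebra S K] [IsFractionRing S K] (f : S),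
          (∀ c : K, c ^ 2 ≠ algebraMap S K f) →
          ∀ (O : ValuationSubring K), (algebraMap S K).range ≤ O.toSubring →
          (∀ s ∈ IsLocalRing.maximalIdeal S, O.valuation (algebraMap S K s) < 1) →
          ∃ (n : ℕ) (B : ℕ → Subring K) (g : ℕ → K),
          B 0 = locAtCentre (algebraMap S K).range O ∧ g 0 = algebraMap S K f ∧
          (∀ i ≤ n, B i ≤ O.toSubring ∧ IsRegularLocalRing (B i) ∧ g i ∈ B i) ∧
          (∀ i < n, ∃ P : Ideal (B i), IsRegularLocalRing ((B i) ⧸ P) ∧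
            IsLocalBlowupAlong O (B i) P (B (i + 1)) ∧
            ∃ c d : K, c ≠ 0 ∧ g (i + 1) = c ^ 2 * g i + d ^ 2) ∧
          ∀ (hg : g n ∈ B n) (_hBn : IsRegularLocalRing (B n)) (c : B n),
            (⟨g n, hg⟩ : B n) - c ^ 2 ∉ IsLocalRing.maximalIdeal (B n) ^ 2))
    (k : Type) [Field k] [CharP k 2] (K : Type) [Field K] [Algebra k K]
    (O : ValuationSubring K) (A : Subalgebra k K) (hAO : A.toSubring ≤ O.toSubring) (hAfg : A.FG)
    (hfrac : IsFractionRing A K) (hreg : IsRegularLocalRing (locAtCentre A.toSubring O))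
    (hdim3 : ringKrullDim (locAtCentre A.toSubring O) = 3) (g₀ : K) (hg₀ : ∀ c : K, c ^ 2 ≠ g₀) :
    ∃ (A' : Subalgebra k K), A'.toSubring ≤ O.toSubring ∧ A ≤ A' ∧ A'.FG ∧
    ∃ (_ : IsRegularLocalRing (locAtCentre A'.toSubring O)) (c : Fin 2 → K), (∃ j : Fin 2, (j : ℕ) ≠ 0 ∧ c j ≠ 0) ∧
    ((∃ (d m : ℕ) (hmd : m ≤ d) (t : Fin d → ↥(locAtCentre A'.toSubring O)) (a : Fin m → ℕ) (u : ↥(locAtCentre A'.toSubring O)),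
      IsUnit u ∧
    Ideal.span (Set.range t) = IsLocalRing.maximalIdeal ↥(locAtCentre A'.toSubring O) ∧
    ringKrullDim ↥(locAtCentre A'.toSubring O) = (d : WithBot ℕ∞) ∧ 0 < m ∧ (∀ i, ¬ 2 ∣ a i) ∧
    (∑ j : Fin 2, c j ^ 2 * g₀ ^ (j : ℕ)) = (u : K) * ∏ i : Fin m, ((t (Fin.castLE hmd i) : ↥(locAtCentre A'.toSubring O)) : K) ^ (a i)) ∨
    (∃ u : ↥(locAtCentre A'.toSubring O), IsUnit u ∧ (∑ j : Fin 2, c j ^ 2 * g₀ ^ (j : ℕ)) = (u : K) ∧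
    ∀ c' : ↥(locAtCentre A'.toSubring O), u - c' ^ 2 ∉ IsLocalRing.maximalIdeal ↥(locAtCentre A'.toSubring O)) ∨
    (∃ s c' : ↥(locAtCentre A'.toSubring O), (∑ j : Fin 2, c j ^ 2 * g₀ ^ (j : ℕ)) = (s : K) ∧
    s - c' ^ 2 ∈ IsLocalRing.maximalIdeal ↥(locAtCentre A'.toSubring O) ∧
    s - c' ^ 2 ∉ IsLocalRing.maximalIdeal ↥(locAtCentre A'.toSubring O) ^ 2)) := by
  classical
  obtain ⟨A', hA'O, hAA', hA'fg, -, hregA', C, D, hGmem, hC, hmultG⟩ :=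
    exists_lowMultModel_of_baseSidePhaseAt 2 Nat.prime_two hBS2 k K O A hAO hAfg hfrac hreg hdim3 g₀ hg₀
  haveI := hregA'
  set R : Subring K := locAtCentre A'.toSubring O with hRdef
  let G : R := ⟨C ^ 2 * g₀ + D ^ 2, hGmem⟩
  let cvec : Fin 2 → K := fun j => if (j : ℕ) = 1 then C else D
  have hsum : (∑ j : Fin 2, cvec j ^ 2 * g₀ ^ (j : ℕ)) = (G : K) := by
    rw [Fin.sum_univ_two]
    simp [cvec, G]
    ring
  refine ⟨A', hA'O, hAA', hA'fg, hregA', cvec, ⟨1, by simp, by simpa [cvec] using hC⟩, ?_⟩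
  by_cases h : ∃ c' : R, G - c' ^ 2 ∈ IsLocalRing.maximalIdeal R
  · obtain ⟨c', hc'⟩ := h
    exact Or.inr (Or.inr ⟨G, c', hsum, hc', hmultG c'⟩)
  · push Not at h
    have hGunit : IsUnit G := by
      by_contra hnu
      apply h 0
      rw [zero_pow two_ne_zero, sub_zero]
      exact (IsLocalRing.mem_maximalIdeal G).mpr hnu
    exact Or.inr (Or.inl ⟨G, hGunit, hsum, h⟩)

/-- (rev-1 name, KEPT) the same from the printed fact BY NAME: `cleanLU3_two_of_baseSidePhaseTwo (hBS 2 Nat.prime_two)`.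
[cite: CossartPiltant2019, Thm. 1.5 (i) pp. 271–272; Cor. 5.6 p. 405; Prop. 2.22 pp. 294–295] -/
theorem cleanLU3_two_of_cp2019BaseSidePhase (hBS : CossartPiltant2019_thm_1_5_i_baseSidePhase.{0})
    (k : Type) [Field k] [CharP k 2] (K : Type) [Field K] [Algebra k K]
    (O : ValuationSubring K) (A : Subalgebra k K) (hAO : A.toSubring ≤ O.toSubring) (hAfg : A.FG)
    (hfrac : IsFractionRing A K) (hreg : IsRegularLocalRing (locAtCentre A.toSubring O))
    (hdim3 : ringKrullDim (locAtCentre A.toSubring O) = 3) (g₀ : K) (hg₀ : ∀ c : K, c ^ 2 ≠ g₀) :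
    ∃ (A' : Subalgebra k K), A'.toSubring ≤ O.toSubring ∧ A ≤ A' ∧ A'.FG ∧
    ∃ (_ : IsRegularLocalRing (locAtCentre A'.toSubring O)) (c : Fin 2 → K), (∃ j : Fin 2, (j : ℕ) ≠ 0 ∧ c j ≠ 0) ∧
    ((∃ (d m : ℕ) (hmd : m ≤ d) (t : Fin d → ↥(locAtCentre A'.toSubring O)) (a : Fin m → ℕ) (u : ↥(locAtCentre A'.toSubring O)),
      IsUnit u ∧
    Ideal.span (Set.range t) = IsLocalRing.maximalIdeal ↥(locAtCentre A'.toSubring O) ∧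
    ringKrullDim ↥(locAtCentre A'.toSubring O) = (d : WithBot ℕ∞) ∧ 0 < m ∧ (∀ i, ¬ 2 ∣ a i) ∧
    (∑ j : Fin 2, c j ^ 2 * g₀ ^ (j : ℕ)) = (u : K) * ∏ i : Fin m, ((t (Fin.castLE hmd i) : ↥(locAtCentre A'.toSubring O)) : K) ^ (a i)) ∨
    (∃ u : ↥(locAtCentre A'.toSubring O), IsUnit u ∧ (∑ j : Fin 2, c j ^ 2 * g₀ ^ (j : ℕ)) = (u : K) ∧
    ∀ c' : ↥(locAtCentre A'.toSubring O), u - c' ^ 2 ∉ IsLocalRing.maximalIdeal ↥(locAtCentre A'.toSubring O)) ∨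
    (∃ s c' : ↥(locAtCentre A'.toSubring O), (∑ j : Fin 2, c j ^ 2 * g₀ ^ (j : ℕ)) = (s : K) ∧
    s - c' ^ 2 ∈ IsLocalRing.maximalIdeal ↥(locAtCentre A'.toSubring O) ∧
    s - c' ^ 2 ∉ IsLocalRing.maximalIdeal ↥(locAtCentre A'.toSubring O) ^ 2)) :=
  cleanLU3_two_of_baseSidePhaseTwo (hBS 2 Nat.prime_two) k K O A hAO hAfg hfrac hreg hdim3 g₀ hg₀

/-! ## §3 Verbatim-binder wrappers for the lead's one-line `by_cases hp2 : p = 2` -/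

/-- **Wrapper at the level of the node `cleanLU3_of_stubs`** (Sketch rev 31 :420, binder list verbatim, plus `p = 2`): usable as
`exact Lens5.PTwo.cleanLU3_of_eq_two stub_cp2019Thm15iBaseSidePhase p hp hp2 k K O A hAO hAfg hfrac hdimA hreg hdim3 hzd g₀ hg₀`.
[cite: CossartPiltant2019, Thm. 1.5 (i) pp. 271–272; Cor. 5.6 p. 405; Prop. 2.22 pp. 294–295] -/
theorem cleanLU3_of_eq_two_of_phaseTwo
    (hBS2 : (∀ (S : Type) [CommRing S] [IsRegularLocalRing S],
          IsExcellentRing S → ringKrullDim S = 3 → CharP S 2 →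
          ∀ (K : Type) [Field K] [Algebra S K] [IsFractionRing S K] (f : S),
          (∀ c : K, c ^ 2 ≠ algebraMap S K f) →
          ∀ (O : ValuationSubring K), (algebraMap S K).range ≤ O.toSubring →
          (∀ s ∈ IsLocalRing.maximalIdeal S, O.valuation (algebraMap S K s) < 1) →
          ∃ (n : ℕ) (B : ℕ → Subring K) (g : ℕ → K),
          B 0 = locAtCentre (algebraMap S K).range O ∧ g 0 = algebraMap S K f ∧
          (∀ i ≤ n, B i ≤ O.toSubring ∧ IsRegularLocalRing (B i) ∧ g i ∈ B i) ∧
          (∀ i < n, ∃ P : Ideal (B i), IsRegularLocalRing ((B i) ⧸ P) ∧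
            IsLocalBlowupAlong O (B i) P (B (i + 1)) ∧
            ∃ c d : K, c ≠ 0 ∧ g (i + 1) = c ^ 2 * g i + d ^ 2) ∧
          ∀ (hg : g n ∈ B n) (_hBn : IsRegularLocalRing (B n)) (c : B n),
            (⟨g n, hg⟩ : B n) - c ^ 2 ∉ IsLocalRing.maximalIdeal (B n) ^ 2)) :
    ∀ (p : ℕ), p.Prime → p = 2 →
    ∀ (k : Type) [Field k] [CharP k p] (K : Type) [Field K] [Algebra k K]
    (O : ValuationSubring K) (A : Subalgebra k K), A.toSubring ≤ O.toSubring → A.FG → IsFractionRing A K →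
    ringKrullDim A ≤ 3 → IsRegularLocalRing (locAtCentre A.toSubring O) →
    ringKrullDim (locAtCentre A.toSubring O) = 3 →
    (∀ (T : Subring K) (hT : T ≤ O.toSubring), A.toSubring ≤ T → (subringCentre T O hT).IsMaximal) →
    ∀ g₀ : K, (∀ c : K, c ^ p ≠ g₀) →
    ∃ (A' : Subalgebra k K), A'.toSubring ≤ O.toSubring ∧ A ≤ A' ∧ A'.FG ∧
    ∃ (_ : IsRegularLocalRing (locAtCentre A'.toSubring O)) (c : Fin p → K), (∃ j : Fin p, (j : ℕ) ≠ 0 ∧ c j ≠ 0) ∧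
    ((∃ (d m : ℕ) (hmd : m ≤ d) (t : Fin d → ↥(locAtCentre A'.toSubring O)) (a : Fin m → ℕ) (u : ↥(locAtCentre A'.toSubring O)),
      IsUnit u ∧
    Ideal.span (Set.range t) = IsLocalRing.maximalIdeal ↥(locAtCentre A'.toSubring O) ∧
    ringKrullDim ↥(locAtCentre A'.toSubring O) = (d : WithBot ℕ∞) ∧ 0 < m ∧ (∀ i, ¬ p ∣ a i) ∧
    (∑ j : Fin p, c j ^ p * g₀ ^ (j : ℕ)) = (u : K) * ∏ i : Fin m, ((t (Fin.castLE hmd i) : ↥(locAtCentre A'.toSubring O)) : K) ^ (a i)) ∨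
    (∃ u : ↥(locAtCentre A'.toSubring O), IsUnit u ∧ (∑ j : Fin p, c j ^ p * g₀ ^ (j : ℕ)) = (u : K) ∧
    ∀ c' : ↥(locAtCentre A'.toSubring O), u - c' ^ p ∉ IsLocalRing.maximalIdeal ↥(locAtCentre A'.toSubring O)) ∨
    (∃ s c' : ↥(locAtCentre A'.toSubring O), (∑ j : Fin p, c j ^ p * g₀ ^ (j : ℕ)) = (s : K) ∧
    s - c' ^ p ∈ IsLocalRing.maximalIdeal ↥(locAtCentre A'.toSubring O) ∧
    s - c' ^ p ∉ IsLocalRing.maximalIdeal ↥(locAtCentre A'.toSubring O) ^ 2)) := by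
  intro p _hp hp2 k _ _ K _ _ O A hAO hAfg hfrac _hdimA hreg hdim3 _hzd g₀ hg₀
  subst hp2
  exact cleanLU3_two_of_baseSidePhaseTwo hBS2 k K O A hAO hAfg hfrac hreg hdim3 g₀ hg₀

/-- (rev-1 name, KEPT) the same wrapper from the printed fact BY NAME: `cleanLU3_of_eq_two_of_phaseTwo (hBS 2 Nat.prime_two)`.
[cite: CossartPiltant2019, Thm. 1.5 (i) pp. 271–272; Cor. 5.6 p. 405; Prop. 2.22 pp. 294–295] -/
theorem cleanLU3_of_eq_two (hBS : CossartPiltant2019_thm_1_5_i_baseSidePhase.{0}) :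
    ∀ (p : ℕ), p.Prime → p = 2 →
    ∀ (k : Type) [Field k] [CharP k p] (K : Type) [Field K] [Algebra k K]
    (O : ValuationSubring K) (A : Subalgebra k K), A.toSubring ≤ O.toSubring → A.FG → IsFractionRing A K →
    ringKrullDim A ≤ 3 → IsRegularLocalRing (locAtCentre A.toSubring O) →
    ringKrullDim (locAtCentre A.toSubring O) = 3 →
    (∀ (T : Subring K) (hT : T ≤ O.toSubring), A.toSubring ≤ T → (subringCentre T O hT).IsMaximal) →
    ∀ g₀ : K, (∀ c : K, c ^ p ≠ g₀) →
    ∃ (A' : Subalgebra k K), A'.toSubring ≤ O.toSubring ∧ A ≤ A' ∧ A'.FG ∧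
    ∃ (_ : IsRegularLocalRing (locAtCentre A'.toSubring O)) (c : Fin p → K), (∃ j : Fin p, (j : ℕ) ≠ 0 ∧ c j ≠ 0) ∧
    ((∃ (d m : ℕ) (hmd : m ≤ d) (t : Fin d → ↥(locAtCentre A'.toSubring O)) (a : Fin m → ℕ) (u : ↥(locAtCentre A'.toSubring O)),
      IsUnit u ∧
    Ideal.span (Set.range t) = IsLocalRing.maximalIdeal ↥(locAtCentre A'.toSubring O) ∧
    ringKrullDim ↥(locAtCentre A'.toSubring O) = (d : WithBot ℕ∞) ∧ 0 < m ∧ (∀ i, ¬ p ∣ a i) ∧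
    (∑ j : Fin p, c j ^ p * g₀ ^ (j : ℕ)) = (u : K) * ∏ i : Fin m, ((t (Fin.castLE hmd i) : ↥(locAtCentre A'.toSubring O)) : K) ^ (a i)) ∨
    (∃ u : ↥(locAtCentre A'.toSubring O), IsUnit u ∧ (∑ j : Fin p, c j ^ p * g₀ ^ (j : ℕ)) = (u : K) ∧
    ∀ c' : ↥(locAtCentre A'.toSubring O), u - c' ^ p ∉ IsLocalRing.maximalIdeal ↥(locAtCentre A'.toSubring O)) ∨
    (∃ s c' : ↥(locAtCentre A'.toSubring O), (∑ j : Fin p, c j ^ p * g₀ ^ (j : ℕ)) = (s : K) ∧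
    s - c' ^ p ∈ IsLocalRing.maximalIdeal ↥(locAtCentre A'.toSubring O) ∧
    s - c' ^ p ∉ IsLocalRing.maximalIdeal ↥(locAtCentre A'.toSubring O) ^ 2)) :=
  cleanLU3_of_eq_two_of_phaseTwo (hBS 2 Nat.prime_two)

/-- **Wrapper at the level of the research stub `stub_cleanLU3DefectNonDiscrete`** (Sketch rev 31 :303, binder list verbatim,
plus `p = 2` right after `p.Prime`): the `p = 2` instance of the class-(B) research stub — and of everything else the stub still
quantifies over — is a corollary of the printed theorem; the eleven restricting hypotheses (centres maximal, immediacy, non-zero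
transcendence defect, not discrete, no divisorial coarsening, not (perfect and `[Γ:2Γ] = 4`), `k` not algebraically closed, rank
one) are simply not used.  Usable as `exact Lens5.PTwo.cleanLU3DefectNonDiscrete_of_eq_two stub_cp2019Thm15iBaseSidePhase p hp hp2
k K O A hAO hAfg hfrac hdimA hreg hdim3 hzd g₀ hg₀ hdefect htd hdisc hdiv hT halg hCc`.
[cite: CossartPiltant2019, Thm. 1.5 (i) pp. 271–272; Cor. 5.6 p. 405; Prop. 2.22 pp. 294–295] -/
theorem cleanLU3DefectNonDiscrete_of_eq_two_of_phaseTwo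
    (hBS2 : (∀ (S : Type) [CommRing S] [IsRegularLocalRing S],
          IsExcellentRing S → ringKrullDim S = 3 → CharP S 2 →
          ∀ (K : Type) [Field K] [Algebra S K] [IsFractionRing S K] (f : S),
          (∀ c : K, c ^ 2 ≠ algebraMap S K f) →
          ∀ (O : ValuationSubring K), (algebraMap S K).range ≤ O.toSubring →
          (∀ s ∈ IsLocalRing.maximalIdeal S, O.valuation (algebraMap S K s) < 1) →
          ∃ (n : ℕ) (B : ℕ → Subring K) (g : ℕ → K),
          B 0 = locAtCentre (algebraMap S K).range O ∧ g 0 = algebraMap S K f ∧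
          (∀ i ≤ n, B i ≤ O.toSubring ∧ IsRegularLocalRing (B i) ∧ g i ∈ B i) ∧
          (∀ i < n, ∃ P : Ideal (B i), IsRegularLocalRing ((B i) ⧸ P) ∧
            IsLocalBlowupAlong O (B i) P (B (i + 1)) ∧
            ∃ c d : K, c ≠ 0 ∧ g (i + 1) = c ^ 2 * g i + d ^ 2) ∧
          ∀ (hg : g n ∈ B n) (_hBn : IsRegularLocalRing (B n)) (c : B n),
            (⟨g n, hg⟩ : B n) - c ^ 2 ∉ IsLocalRing.maximalIdeal (B n) ^ 2)) :
    ∀ (p : ℕ), p.Prime → p = 2 →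
    ∀ (k : Type) [Field k] [CharP k p] (K : Type) [Field K] [Algebra k K]
    (O : ValuationSubring K) (A : Subalgebra k K), A.toSubring ≤ O.toSubring → A.FG → IsFractionRing A K →
    ringKrullDim A ≤ 3 → IsRegularLocalRing (locAtCentre A.toSubring O) →
    ringKrullDim (locAtCentre A.toSubring O) = 3 →
    (∀ (T : Subring K) (hT : T ≤ O.toSubring), A.toSubring ≤ T → (subringCentre T O hT).IsMaximal) →
    ∀ g₀ : K, (∀ c : K, c ^ p ≠ g₀) →
    (∀ f₀ : K, ∃ f₁ : K, O.valuation (g₀ - f₁ ^ p) < O.valuation (g₀ - f₀ ^ p)) →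
    (∀ hk : ∀ c : k, algebraMap k K c ∈ O, transcendenceDefect k O hk ≠ 0) →
    ¬ (∃ π : K, π ≠ 0 ∧ (∀ x : K, O.valuation x < 1 → O.valuation x ≤ O.valuation π) ∧
      (∀ x : K, x ≠ 0 → ∃ n : ℕ, O.valuation π ^ n ≤ O.valuation x)) →
    ¬ (∃ (O₁ : ValuationSubring K), O ≤ O₁ ∧ O₁ ≠ ⊤ ∧ ∃ y : Fin 2 → K, (∀ i, y i ∈ O) ∧
      ∀ P : MvPolynomial (Fin 2) k, P ≠ 0 → O₁.valuation (MvPolynomial.aeval y P) = 1) →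
    ¬ (PerfectField k ∧ ∃ x y : K, x ≠ 0 ∧ y ≠ 0 ∧ ∀ a b : ℕ, a < p → b < p → (a ≠ 0 ∨ b ≠ 0) →
      ∀ z : K, z ≠ 0 → O.valuation (x ^ a * y ^ b) ≠ O.valuation (z ^ p)) →
    ¬ IsAlgClosed k →
    ¬ (∃ O₁ : ValuationSubring K, O ≤ O₁ ∧ O₁ ≠ O ∧ O₁ ≠ ⊤) →
    ∃ (A' : Subalgebra k K), A'.toSubring ≤ O.toSubring ∧ A ≤ A' ∧ A'.FG ∧
    ∃ (_ : IsRegularLocalRing (locAtCentre A'.toSubring O)) (c : Fin p → K), (∃ j : Fin p, (j : ℕ) ≠ 0 ∧ c j ≠ 0) ∧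
    ((∃ (d m : ℕ) (hmd : m ≤ d) (t : Fin d → ↥(locAtCentre A'.toSubring O)) (a : Fin m → ℕ) (u : ↥(locAtCentre A'.toSubring O)),
      IsUnit u ∧
    Ideal.span (Set.range t) = IsLocalRing.maximalIdeal ↥(locAtCentre A'.toSubring O) ∧
    ringKrullDim ↥(locAtCentre A'.toSubring O) = (d : WithBot ℕ∞) ∧ 0 < m ∧ (∀ i, ¬ p ∣ a i) ∧
    (∑ j : Fin p, c j ^ p * g₀ ^ (j : ℕ)) = (u : K) * ∏ i : Fin m, ((t (Fin.castLE hmd i) : ↥(locAtCentre A'.toSubring O)) : K) ^ (a i)) ∨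
    (∃ u : ↥(locAtCentre A'.toSubring O), IsUnit u ∧ (∑ j : Fin p, c j ^ p * g₀ ^ (j : ℕ)) = (u : K) ∧
    ∀ c' : ↥(locAtCentre A'.toSubring O), u - c' ^ p ∉ IsLocalRing.maximalIdeal ↥(locAtCentre A'.toSubring O)) ∨
    (∃ s c' : ↥(locAtCentre A'.toSubring O), (∑ j : Fin p, c j ^ p * g₀ ^ (j : ℕ)) = (s : K) ∧
    s - c' ^ p ∈ IsLocalRing.maximalIdeal ↥(locAtCentre A'.toSubring O) ∧
    s - c' ^ p ∉ IsLocalRing.maximalIdeal ↥(locAtCentre A'.toSubring O) ^ 2)) := by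
  intro p _hp hp2 k _ _ K _ _ O A hAO hAfg hfrac _hdimA hreg hdim3 _hzd g₀ hg₀ _hdefect _htd _hdisc _hdiv _hT _halg _hCc
  subst hp2
  exact cleanLU3_two_of_baseSidePhaseTwo hBS2 k K O A hAO hAfg hfrac hreg hdim3 g₀ hg₀

/-- (rev-1 name, KEPT) the same wrapper from the printed fact BY NAME: `cleanLU3DefectNonDiscrete_of_eq_two_of_phaseTwo (hBS 2 Nat.prime_two)`.
[cite: CossartPiltant2019, Thm. 1.5 (i) pp. 271–272; Cor. 5.6 p. 405; Prop. 2.22 pp. 294–295] -/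
theorem cleanLU3DefectNonDiscrete_of_eq_two (hBS : CossartPiltant2019_thm_1_5_i_baseSidePhase.{0}) :
    ∀ (p : ℕ), p.Prime → p = 2 →
    ∀ (k : Type) [Field k] [CharP k p] (K : Type) [Field K] [Algebra k K]
    (O : ValuationSubring K) (A : Subalgebra k K), A.toSubring ≤ O.toSubring → A.FG → IsFractionRing A K →
    ringKrullDim A ≤ 3 → IsRegularLocalRing (locAtCentre A.toSubring O) →
    ringKrullDim (locAtCentre A.toSubring O) = 3 →
    (∀ (T : Subring K) (hT : T ≤ O.toSubring), A.toSubring ≤ T → (subringCentre T O hT).IsMaximal) →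
    ∀ g₀ : K, (∀ c : K, c ^ p ≠ g₀) →
    (∀ f₀ : K, ∃ f₁ : K, O.valuation (g₀ - f₁ ^ p) < O.valuation (g₀ - f₀ ^ p)) →
    (∀ hk : ∀ c : k, algebraMap k K c ∈ O, transcendenceDefect k O hk ≠ 0) →
    ¬ (∃ π : K, π ≠ 0 ∧ (∀ x : K, O.valuation x < 1 → O.valuation x ≤ O.valuation π) ∧
      (∀ x : K, x ≠ 0 → ∃ n : ℕ, O.valuation π ^ n ≤ O.valuation x)) →
    ¬ (∃ (O₁ : ValuationSubring K), O ≤ O₁ ∧ O₁ ≠ ⊤ ∧ ∃ y : Fin 2 → K, (∀ i, y i ∈ O) ∧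
      ∀ P : MvPolynomial (Fin 2) k, P ≠ 0 → O₁.valuation (MvPolynomial.aeval y P) = 1) →
    ¬ (PerfectField k ∧ ∃ x y : K, x ≠ 0 ∧ y ≠ 0 ∧ ∀ a b : ℕ, a < p → b < p → (a ≠ 0 ∨ b ≠ 0) →
      ∀ z : K, z ≠ 0 → O.valuation (x ^ a * y ^ b) ≠ O.valuation (z ^ p)) →
    ¬ IsAlgClosed k →
    ¬ (∃ O₁ : ValuationSubring K, O ≤ O₁ ∧ O₁ ≠ O ∧ O₁ ≠ ⊤) →
    ∃ (A' : Subalgebra k K), A'.toSubring ≤ O.toSubring ∧ A ≤ A' ∧ A'.FG ∧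
    ∃ (_ : IsRegularLocalRing (locAtCentre A'.toSubring O)) (c : Fin p → K), (∃ j : Fin p, (j : ℕ) ≠ 0 ∧ c j ≠ 0) ∧
    ((∃ (d m : ℕ) (hmd : m ≤ d) (t : Fin d → ↥(locAtCentre A'.toSubring O)) (a : Fin m → ℕ) (u : ↥(locAtCentre A'.toSubring O)),
      IsUnit u ∧
    Ideal.span (Set.range t) = IsLocalRing.maximalIdeal ↥(locAtCentre A'.toSubring O) ∧
    ringKrullDim ↥(locAtCentre A'.toSubring O) = (d : WithBot ℕ∞) ∧ 0 < m ∧ (∀ i, ¬ p ∣ a i) ∧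
    (∑ j : Fin p, c j ^ p * g₀ ^ (j : ℕ)) = (u : K) * ∏ i : Fin m, ((t (Fin.castLE hmd i) : ↥(locAtCentre A'.toSubring O)) : K) ^ (a i)) ∨
    (∃ u : ↥(locAtCentre A'.toSubring O), IsUnit u ∧ (∑ j : Fin p, c j ^ p * g₀ ^ (j : ℕ)) = (u : K) ∧
    ∀ c' : ↥(locAtCentre A'.toSubring O), u - c' ^ p ∉ IsLocalRing.maximalIdeal ↥(locAtCentre A'.toSubring O)) ∨
    (∃ s c' : ↥(locAtCentre A'.toSubring O), (∑ j : Fin p, c j ^ p * g₀ ^ (j : ℕ)) = (s : K) ∧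
    s - c' ^ p ∈ IsLocalRing.maximalIdeal ↥(locAtCentre A'.toSubring O) ∧
    s - c' ^ p ∉ IsLocalRing.maximalIdeal ↥(locAtCentre A'.toSubring O) ^ 2)) :=
  cleanLU3DefectNonDiscrete_of_eq_two_of_phaseTwo (hBS 2 Nat.prime_two)

end Summit.ResolutionOfSingularities.ResolutionOfSingularities.Theorems.RadicialJung.CleanModels.Lens5.PTwo

end
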